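import Summits.ResolutionOfSingularities.ResolutionOfSingularities.Theorems.WeightedInvariantIota3TieZeroOrderPersists
import HarnessLib

/-!
# The SHAPE of the saturated transform at a curve centre in AQS-adapted normal form: `g = c·Y^ν + t⁻¹·H`
# (door `HypersurfaceCentreConstruction`, stmt-ResolutionOfSingularities-19897; residual (D-b³-curve-FRAC-TIE-ZERO) of `stub_keyRungGrHomLE_three`)

Topic: `Summits/ResolutionOfSingularities/ResolutionOfSingularities/Theorems`. Helper for the door item `HypersurfaceCentreConstruction`
(stmt-ResolutionOfSingularities-19897, route `WeightedInvariant`), line `local-engine`, def-free.  CURVE-TIE.md §3 (a) in the kernel: with the normal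
form `f = c y^ν + h`, `h ∈ 𝒥_{rν+1}((y,x);(r,q))` (hand -8's `mem_span_pow_sup_of_curve_lexMax_frac`, hand -9's `exists_normalForm_of_mem_sup`), the saturated
transform `g` of `f` (`f = (t⁻¹)^{rν} g`, `t⁻¹ ∤ g`) in `B = S[t⁻¹, 𝒥ₙ tⁿ]` is
`g = c·Y^ν + t⁻¹·H` (`Y = y t^r`, some `H ∈ B`): the strict transform is `c Y^ν` MODULO `t⁻¹`.

* **`LocalGameEFTCylinder.exists_transform_eq_of_normalForm`** (chart form, `Y = uT 0`);
* **`Iota3.exists_transform_eq_of_normalForm_aux`** / **`Iota3.exists_transform_eq_of_normalForm`** (every presentation `(u, w)`, intrinsic `W`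
  with `y = (t⁻¹)^r W`): `∃ H, g = c·W^ν + t⁻¹·H`.
Input for the `σ`/`ε`-analysis at the residual point `𝔫 = (t⁻¹, z, W)` of `keyRungGrHomLE_three_of_tieDescent_point_curveFracTieZero` (there `B_𝔫` has regular
parameters `(t⁻¹, z, W)` and `g/1 = c W^ν + (t⁻¹) H`, `c` a unit).
[OURS · L1 W4.3 · (D-b³-curve-FRAC-TIE) orientation]  Replaces the role of NO printed item; NOT a statement of the manuscript under review
[claim: Hironaka2017, status: under-review]; candidates stay candidates; AI work, weaker than expert review.  No definition; no axiom.

## References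

* J. Włodarczyk, *Functorial resolution by torus actions*, arXiv:2203.03090, §3.3 (strict transforms on the full cobordant blow-up). [Wlodarczyk2022]
-/

noncomputable section

open IsLocalRing Literature.AlgebraicGeometry.Resolution
open Summit.ResolutionOfSingularities.ResolutionOfSingularities.Cruxes.HypersurfaceCentreConstruction.LocalEngine

set_option linter.dupNamespace false -- mandated namespace of this single-conjunct summit

namespace Summit.ResolutionOfSingularities.ResolutionOfSingularities.Theorems

namespace LocalGameEFTCylinder

variable {S : Type} [CommRing S] [IsRegularLocalRing S] {y x z : S} {r q : ℕ}

/-- Every element of `𝒥ₙ` is `(t⁻¹)ⁿ` times an element of `B`. [cite: Wlodarczyk2022, §3.3] -/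
theorem exists_algebraMap_eq_tInv_pow_mul (hyxz : Ideal.span (Set.range ![y, x, z]) = maximalIdeal S)
    (hd : (maximalIdeal S).spanFinrank = 3) (hq : 0 < q) (hqr : q ≤ r) {n : ℕ} {h : S}
    (hh : h ∈ weightedMonomialIdeal ![y, x] ![r, q] n) :
    ∃ H : extReesAlgebra (weightedMonomialIdeal ![y, x] ![r, q]),
      algebraMap S _ h = extReesAlgebra.tInv (weightedMonomialIdeal ![y, x] ![r, q]) ^ n * H := by
  classical
  obtain ⟨ρ₀, _, _, hX, hC, hT0⟩ := exists_rhoZero hyxz hd ![r, q] (weights_pos hq hqr)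
  obtain ⟨l, hl, hhl⟩ := exists_finsupp_of_mem_weightedMonomialIdeal ![y, x] ![r, q] hh
  obtain ⟨H, hH, -⟩ := exists_transform_of_finsupp ![y, x] ![r, q] (residue S) ρ₀ hX hC hT0 l hl hhl
  exact ⟨H, hH⟩

/-- **The transform in normal form: `g = c·Y^ν + t⁻¹·H`.**  `f = c y^ν + h`, `h ∈ 𝒥_{rν+1}((y,x);(r,q))`, `f ∈ 𝒥_{rν} ∖ 𝔪^{ν+1}`; for every saturated
factorisation `f = (t⁻¹)ᵃ g`, `t⁻¹ ∤ g`: `∃ H, g = c·Y^ν + t⁻¹·H` (`Y = y t^r`). [OURS · L1 W4.3 · CURVE-TIE.md §3 (a)] [cite: Wlodarczyk2022, §3.3] -/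
theorem exists_transform_eq_of_normalForm (hyxz : Ideal.span (Set.range ![y, x, z]) = maximalIdeal S)
    (hd : (maximalIdeal S).spanFinrank = 3) (hq : 0 < q) (hqr : q ≤ r) {ν : ℕ} {f c h : S}
    (hfν : f ∉ maximalIdeal S ^ (ν + 1)) (hadm : f ∈ weightedMonomialIdeal ![y, x] ![r, q] (r * ν))
    (hh : h ∈ weightedMonomialIdeal ![y, x] ![r, q] (r * ν + 1)) (hf : f = c * y ^ ν + h)
    {a : ℕ} {g : extReesAlgebra (weightedMonomialIdeal ![y, x] ![r, q])}
    (hfg : algebraMap S _ f = extReesAlgebra.tInv (weightedMonomialIdeal ![y, x] ![r, q]) ^ a * g)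
    (hndvd : ¬ extReesAlgebra.tInv (weightedMonomialIdeal ![y, x] ![r, q]) ∣ g) :
    ∃ H : extReesAlgebra (weightedMonomialIdeal ![y, x] ![r, q]),
      g = algebraMap S _ c * LocalGameEFTPointMove.uT ![y, x] ![r, q] 0 ^ ν + extReesAlgebra.tInv (weightedMonomialIdeal ![y, x] ![r, q]) * H := by
  haveI := isDomain_of_isRegularLocalRing S
  have ha : a = r * ν := transform_eq_of_saturated hyxz hd hq hqr hfν hadm hfg hndvd
  subst ha
  obtain ⟨H, hH⟩ := exists_algebraMap_eq_tInv_pow_mul hyxz hd hq hqr hh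
  refine ⟨H, ?_⟩
  have hTne : extReesAlgebra.tInv (weightedMonomialIdeal ![y, x] ![r, q]) ≠ 0 := nonZeroDivisors.ne_zero (tInv_mem_nonZeroDivisors _)
  refine mul_left_cancel₀ (pow_ne_zero (r * ν) hTne) ?_
  rw [← hfg, hf, map_add, map_mul, map_pow, algebraMap_y_eq, hH, mul_pow, ← pow_mul, pow_succ]
  ring

end LocalGameEFTCylinder

end Summit.ResolutionOfSingularities.ResolutionOfSingularities.Theorems

namespace Summit.ResolutionOfSingularities.ResolutionOfSingularities.Cruxes.HypersurfaceCentreConstruction.LocalEngine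

namespace Iota3

open Summit.ResolutionOfSingularities.ResolutionOfSingularities.Theorems

/-- Carrier transport of the transform shape to ANY filtration equal to `𝒥((y,x);(r,q))`, with the intrinsic `W` (`y = (t⁻¹)^r W`). [OURS · seam] -/
theorem exists_transform_eq_of_normalForm_aux {S : Type} [CommRing S] [IsRegularLocalRing S] {y x z : S} {q r ν : ℕ} {f c h : S}
    (hyxz : Ideal.span (Set.range ![y, x, z]) = maximalIdeal S) (hd : (maximalIdeal S).spanFinrank = 3)
    (hq : 0 < q) (hqr : q ≤ r) (hfν : f ∉ maximalIdeal S ^ (ν + 1)) (hadm : f ∈ weightedMonomialIdeal ![y, x] ![r, q] (r * ν))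
    (hh : h ∈ weightedMonomialIdeal ![y, x] ![r, q] (r * ν + 1)) (hf : f = c * y ^ ν + h)
    {I : ℕ → Ideal S} (hI : I = weightedMonomialIdeal ![y, x] ![r, q]) :
    ∀ W : extReesAlgebra I, algebraMap S (extReesAlgebra I) y = extReesAlgebra.tInv I ^ r * W →
      ∀ (a : ℕ) (g : extReesAlgebra I), algebraMap S (extReesAlgebra I) f = extReesAlgebra.tInv I ^ a * g →
        ¬ extReesAlgebra.tInv I ∣ g →
        ∃ H : extReesAlgebra I, g = algebraMap S _ c * W ^ ν + extReesAlgebra.tInv I * H := by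
  subst hI
  haveI := isDomain_of_isRegularLocalRing S
  intro W hW a g hfg hTg
  rw [LocalGameEFTCylinder.eq_uT_zero_of_algebraMap_y_eq hW]
  exact LocalGameEFTCylinder.exists_transform_eq_of_normalForm hyxz hd hq hqr hfν hadm hh hf hfg hTg

/-- **The saturated transform is `c·W^ν + t⁻¹·H`, for EVERY presentation `(u, w)`** of `𝒥((y,x);(r,q))` (`f = c y^ν + h`, `h ∈ 𝒥_{rν+1}`,
`f ∈ 𝒥_{rν} ∖ 𝔪^{ν+1}`, `y = (t⁻¹)^r W`): input for the analysis at the residual point of `keyRungGrHomLE_three_of_tieDescent_point_curveFracTieZero`.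
[OURS · L1 W4.3 · CURVE-TIE.md §3 (a)] [cite: Wlodarczyk2022, §3.3] -/
theorem exists_transform_eq_of_normalForm {S : Type} [CommRing S] [IsRegularLocalRing S] {y x z : S} {q r ν : ℕ} {f c h : S}
    (hyxz : Ideal.span (Set.range ![y, x, z]) = maximalIdeal S) (hd : (maximalIdeal S).spanFinrank = 3)
    (hq : 0 < q) (hqr : q ≤ r) (hfν : f ∉ maximalIdeal S ^ (ν + 1)) (hadm : f ∈ weightedMonomialIdeal ![y, x] ![r, q] (r * ν))
    (hh : h ∈ weightedMonomialIdeal ![y, x] ![r, q] (r * ν + 1)) (hf : f = c * y ^ ν + h)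
    {n : ℕ} (u : Fin n → S) (w : Fin n → ℕ) (hpres : ∀ m : ℕ, weightedMonomialIdeal u w m = weightedMonomialIdeal ![y, x] ![r, q] m)
    (W : cobordantAlgebra' u w) (hW : algebraMap S (cobordantAlgebra' u w) y = cobordantT' u w ^ r * W)
    {a : ℕ} {g : cobordantAlgebra' u w} (hfg : algebraMap S (cobordantAlgebra' u w) f = cobordantT' u w ^ a * g)
    (hTg : ¬ cobordantT' u w ∣ g) :
    ∃ H : cobordantAlgebra' u w, g = algebraMap S _ c * W ^ ν + cobordantT' u w * H :=
  exists_transform_eq_of_normalForm_aux hyxz hd hq hqr hfν hadm hh hf (funext hpres) W hW a g hfg hTg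

end Iota3

end Summit.ResolutionOfSingularities.ResolutionOfSingularities.Cruxes.HypersurfaceCentreConstruction.LocalEngine

end
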